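import Summits.AtomisticToContinuum.HydrodynamicLimit.Theorems.AntiMazurCoboundariesCorrectorPressureDecayTangentTightnessLaplace
import Mathlib.Analysis.SpecialFunctions.BinaryEntropy

/-!
# Entropy bound for tangent states, I: mixture lemmas (line `FirstLemma`, crux stmt-AtomisticToContinuum-14135)

Helper file of the registered stub `stub_tangentEntropyBound : TangentEntropyBound` (F2 of
`…KiferTangentEntropyDebt.lean`; idea `kifer-compactification`), namespace
`Summit.AtomisticToContinuum.HydrodynamicLimit.Theorems.KiferCompactification`. Closed, reusable lemmas behind the
AFFINITY REDUCTION of the weighted entropy bound to the unit weight (file `…KiferEntropyBoundAffinity.lean`):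

* `ofReal_mul_klDiv_le_klDiv_mix_add_log_two` — REVERSE CONVEXITY of the Kullback–Leibler divergence under a two-point
  mixture, `t · KL(P ‖ R) ≤ KL(t P + (1-t) P' ‖ R) + log 2` (pointwise `t x log x ≤ t x log m + t x log t⁻¹` for
  `t x ≤ m`, integrated against `R`; the deficit is the binary entropy `H(t) ≤ log 2`, Mathlib `Real.binEntropy_le_log_two`);
* `exists_strictMono_tendsto_liminf` — a bounded real sequence has a subsequence converging to its `liminf`;
* `isTangentFamily_reindex` — tangent families re-indexed along a strictly increasing map are tangent families;
* `integrable_innerLaplace`, `integral_mul_tangentLaplace`, `tangentLaplace_one`, `tangentLaplace_one_eq_add` — the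
  blown-up Laplace functional is AFFINE IN THE WEIGHT: `tangentLaplace σ 1 = (∫φ) · tangentLaplace σ φ + ∫ (1 - φ) · inner`;
* `laplaceFunctional_smul_add`, `windowLaw_smul_add` — Laplace functionals and window laws of two-point mixtures;
* `natCast_le_volume_centredBox`, `tendsto_const_div_volume_centredBox` — the centred cubes `Λ_n` have volume `≥ n`;
* `stub_specificRelEntropyMixture` (REGISTERED stub of this helper file) — the lower half of the AFFINITY of the specific
  relative entropy: `t · h(μ | G) ≤ h(t μ + (1-t) ν | G)` for probability laws and `0 ≤ t ≤ 1` (window by window, the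
  reverse convexity costs `log 2`, negligible per unit volume; Georgii–Zessin 1993 Remark 2.5 (2) "I is affine").

References: Georgii–Zessin 1993 (PTRF 96) Remark 2.5; Olla–Varadhan–Yau 1993 (CMP 155) §5 (context).
-/

noncomputable section

open MeasureTheory ProbabilityTheory Set Filter Topology InformationTheory
open scoped ENNReal NNReal

namespace Summit.AtomisticToContinuum.HydrodynamicLimit.Theorems.KiferCompactification

open Literature.MathematicalPhysics.KineticTheory (T3 V3 hsDiameter localGibbsLaw blowUpPoint blowUp)
open Literature.MathematicalPhysics.KineticTheory.PointProcess (laplaceFunctional specificRelEntropy windowLaw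
  windowRestrict centredBox measurable_windowRestrict isProbabilityMeasure_windowLaw integrable_exp_neg_finsum)
open Literature.Analysis.FluidPDE (HardSphereFlow Config)
open Literature.Analysis.FunctionSpaces (PointConfig)

/-! ### 1. Reverse convexity of the Kullback–Leibler divergence -/

section RevConvex

variable {α : Type*} [MeasurableSpace α]

/-- For `0 ≤ s`, `0 ≤ x` and `s x ≤ m`: `s x log x ≤ s x log m + s x log s⁻¹` (with `0 log 0 = 0`). -/
private theorem mul_mul_log_le (s x m : ℝ) (hs : 0 ≤ s) (hx : 0 ≤ x) (hle : s * x ≤ m) :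
    s * x * Real.log x ≤ s * x * Real.log m + s * x * Real.log s⁻¹ := by
  rcases (mul_nonneg hs hx).eq_or_lt with h0 | hpos
  · rw [← h0]; simp
  · have hs' : 0 < s := lt_of_le_of_ne hs (by rintro rfl; simp at hpos)
    have hx' : 0 < x := lt_of_le_of_ne hx (by rintro rfl; simp at hpos)
    have hlog : Real.log x = Real.log (s * x) + Real.log s⁻¹ := by
      rw [Real.log_mul hs'.ne' hx'.ne', Real.log_inv]; ring
    rw [hlog, mul_add]
    gcongr s * x * ?_ + _
    exact Real.log_le_log hpos hle

/-- Pointwise reverse convexity of `klFun`: for `0 ≤ t ≤ 1`, `p, q ≥ 0`,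
`t klFun p ≤ klFun (t p + (1-t) q) + t p log t⁻¹ + (1-t) q log (1-t)⁻¹`. -/
private theorem mul_klFun_le (t p q : ℝ) (ht0 : 0 ≤ t) (ht1 : t ≤ 1) (hp : 0 ≤ p) (hq : 0 ≤ q) :
    t * klFun p ≤ klFun (t * p + (1 - t) * q) +
      (t * p * Real.log t⁻¹ + (1 - t) * q * Real.log (1 - t)⁻¹) := by
  have ht1' : 0 ≤ 1 - t := sub_nonneg.2 ht1
  have h1 := mul_mul_log_le t p (t * p + (1 - t) * q) ht0 hp (by nlinarith [mul_nonneg ht1' hq])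
  have h2 := mul_mul_log_le (1 - t) q (t * p + (1 - t) * q) ht1' hq (by nlinarith [mul_nonneg ht0 hp])
  have h3 : 0 ≤ (1 - t) * klFun q := mul_nonneg ht1' (klFun_nonneg hq)
  have e2 : (1 - t) * klFun q = (1 - t) * q * Real.log q + (1 - t) - (1 - t) * q := by rw [klFun_apply]; ring
  have e3 : klFun (t * p + (1 - t) * q) =
      t * p * Real.log (t * p + (1 - t) * q) + (1 - t) * q * Real.log (t * p + (1 - t) * q) + 1 -
        (t * p + (1 - t) * q) := by rw [klFun_apply]; ring
  rw [e3, klFun_apply]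
  rw [e2] at h3
  nlinarith [h1, h2, h3]

/-- The entropy term above is nonnegative. -/
private theorem entropyTerm_nonneg (t p q : ℝ) (ht0 : 0 ≤ t) (ht1 : t ≤ 1) (hp : 0 ≤ p) (hq : 0 ≤ q) :
    0 ≤ t * p * Real.log t⁻¹ + (1 - t) * q * Real.log (1 - t)⁻¹ := by
  have ha : 0 ≤ Real.log t⁻¹ := by
    rcases ht0.eq_or_lt with h | ht
    · rw [← h]; simp
    · exact Real.log_nonneg ((one_le_inv₀ ht).2 ht1)
  have hb : 0 ≤ Real.log (1 - t)⁻¹ := by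
    rcases (sub_nonneg.2 ht1).eq_or_lt with h | h
    · rw [← h]; simp
    · exact Real.log_nonneg ((one_le_inv₀ h).2 (by linarith))
  have := mul_nonneg (mul_nonneg ht0 hp) ha
  have := mul_nonneg (mul_nonneg (sub_nonneg.2 ht1) hq) hb
  linarith

/-- **Reverse convexity of the Kullback–Leibler divergence.** For probability measures `P, P', R` and `0 ≤ t ≤ 1`:
`t · KL(P ‖ R) ≤ KL(t P + (1 - t) P' ‖ R) + log 2` — the concavity deficit of `KL(· ‖ R)` under a two-point
mixture is at most the binary entropy `H(t) ≤ log 2` of the mixing weight. -/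
theorem ofReal_mul_klDiv_le_klDiv_mix_add_log_two (P P' R : Measure α) [IsProbabilityMeasure P]
    [IsProbabilityMeasure P'] [IsProbabilityMeasure R] {t : ℝ} (ht0 : 0 ≤ t) (ht1 : t ≤ 1) :
    ENNReal.ofReal t * klDiv P R ≤
      klDiv (t.toNNReal • P + (1 - t).toNNReal • P') R + ENNReal.ofReal (Real.log 2) := by
  set M : Measure α := t.toNNReal • P + (1 - t).toNNReal • P' with hM
  by_cases hac : M ≪ R
  swap
  · rw [klDiv_of_not_ac hac, top_add]; exact le_top
  rcases ht0.eq_or_lt with h | htpos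
  · rw [← h]; simp
  -- `P ≪ R`
  have hPR : P ≪ R := by
    refine Measure.AbsolutelyContinuous.mk fun s _ hRs => ?_
    have hMs : M s = 0 := hac hRs
    have hle : (t.toNNReal • P) s ≤ M s := by rw [hM]; exact Measure.le_add_right le_rfl s
    rw [hMs, Measure.smul_apply, nonpos_iff_eq_zero, smul_eq_zero] at hle
    rcases hle with h | h
    · exact absurd h (by simp [htpos])
    · exact h
  -- densities
  set p : α → ℝ≥0∞ := P.rnDeriv R
  set q : α → ℝ≥0∞ := P'.rnDeriv R
  have hm : M.rnDeriv R =ᵐ[R] fun x => (t.toNNReal : ℝ≥0∞) * p x + ((1 - t).toNNReal : ℝ≥0∞) * q x := by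
    have h1 := Measure.rnDeriv_add (t.toNNReal • P) ((1 - t).toNNReal • P') R
    have h2 := Measure.rnDeriv_smul_left P R t.toNNReal
    have h3 := Measure.rnDeriv_smul_left P' R (1 - t).toNNReal
    filter_upwards [h1, h2, h3] with x hx1 hx2 hx3
    rw [hM, hx1, Pi.add_apply, hx2, hx3]
    simp [ENNReal.smul_def, p, q]
  have hp_top : ∀ᵐ x ∂ R, p x ≠ ∞ := Measure.rnDeriv_ne_top P R
  have hq_top : ∀ᵐ x ∂ R, q x ≠ ∞ := Measure.rnDeriv_ne_top P' R
  rw [klDiv_eq_lintegral_klFun_of_ac hPR, klDiv_eq_lintegral_klFun_of_ac hac]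
  have hmeas : Measurable fun x => ENNReal.ofReal (klFun (p x).toReal) := by fun_prop
  rw [← lintegral_const_mul _ hmeas]
  have hpt : ∀ᵐ x ∂ R, ENNReal.ofReal t * ENNReal.ofReal (klFun (p x).toReal) ≤
      ENNReal.ofReal (klFun (M.rnDeriv R x).toReal) +
        ENNReal.ofReal (t * (p x).toReal * Real.log t⁻¹ + (1 - t) * (q x).toReal * Real.log (1 - t)⁻¹) := by
    filter_upwards [hm, hp_top, hq_top] with x hx hpx hqx
    have hmx : (M.rnDeriv R x).toReal = t * (p x).toReal + (1 - t) * (q x).toReal := by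
      rw [hx, ENNReal.toReal_add (ENNReal.mul_ne_top ENNReal.coe_ne_top hpx)
        (ENNReal.mul_ne_top ENNReal.coe_ne_top hqx), ENNReal.toReal_mul, ENNReal.toReal_mul]
      simp [Real.coe_toNNReal _ ht0, Real.coe_toNNReal _ (sub_nonneg.2 ht1)]
    rw [← ENNReal.ofReal_mul ht0, hmx, ← ENNReal.ofReal_add (klFun_nonneg (by positivity))
      (entropyTerm_nonneg t _ _ ht0 ht1 ENNReal.toReal_nonneg ENNReal.toReal_nonneg)]
    exact ENNReal.ofReal_le_ofReal (mul_klFun_le t _ _ ht0 ht1 ENNReal.toReal_nonneg ENNReal.toReal_nonneg)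
  refine (lintegral_mono_ae hpt).trans ?_
  rw [lintegral_add_left (by fun_prop)]
  gcongr
  have ha : 0 ≤ t * Real.log t⁻¹ := mul_nonneg ht0 (Real.log_nonneg ((one_le_inv₀ htpos).2 ht1))
  have hb : 0 ≤ (1 - t) * Real.log (1 - t)⁻¹ := by
    rcases (sub_nonneg.2 ht1).eq_or_lt with h | h
    · rw [← h]; simp
    · exact mul_nonneg h.le (Real.log_nonneg ((one_le_inv₀ h).2 (by linarith)))
  have hsplit : ∀ x, ENNReal.ofReal (t * (p x).toReal * Real.log t⁻¹ + (1 - t) * (q x).toReal * Real.log (1 - t)⁻¹) =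
      ENNReal.ofReal (t * Real.log t⁻¹) * ENNReal.ofReal (p x).toReal +
        ENNReal.ofReal ((1 - t) * Real.log (1 - t)⁻¹) * ENNReal.ofReal (q x).toReal := by
    intro x
    rw [← ENNReal.ofReal_mul ha, ← ENNReal.ofReal_mul hb,
      ← ENNReal.ofReal_add (by positivity) (by positivity)]
    congr 1; ring
  simp_rw [hsplit]
  rw [lintegral_add_left (by fun_prop), lintegral_const_mul _ (by fun_prop), lintegral_const_mul _ (by fun_prop)]
  have hIp : ∫⁻ x, ENNReal.ofReal (p x).toReal ∂ R = 1 := by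
    rw [lintegral_congr_ae (hp_top.mono fun x hx => ENNReal.ofReal_toReal hx)]
    rw [Measure.lintegral_rnDeriv hPR, measure_univ]
  have hP'R : P' ≪ R ∨ t = 1 := by
    rcases eq_or_lt_of_le ht1 with h | h
    · exact Or.inr h
    · left
      refine Measure.AbsolutelyContinuous.mk fun s _ hRs => ?_
      have hMs : M s = 0 := hac hRs
      have hle : ((1 - t).toNNReal • P') s ≤ M s := by rw [hM]; exact Measure.le_add_left le_rfl s
      rw [hMs, Measure.smul_apply, nonpos_iff_eq_zero, smul_eq_zero] at hle
      rcases hle with h' | h'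
      · exact absurd h' (by simp [h])
      · exact h'
  have hIq : ENNReal.ofReal ((1 - t) * Real.log (1 - t)⁻¹) * ∫⁻ x, ENNReal.ofReal (q x).toReal ∂ R =
      ENNReal.ofReal ((1 - t) * Real.log (1 - t)⁻¹) := by
    rcases hP'R with h | h
    · rw [lintegral_congr_ae (hq_top.mono fun x hx => ENNReal.ofReal_toReal hx),
        Measure.lintegral_rnDeriv h, measure_univ, mul_one]
    · rw [h]; simp
  rw [hIp, mul_one, hIq, ← ENNReal.ofReal_add ha hb]
  refine ENNReal.ofReal_le_ofReal ?_
  have := Real.binEntropy_le_log_two (p := t)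
  rw [Real.binEntropy] at this
  linarith

end RevConvex

/-! ### 2. A subsequence along which a bounded sequence tends to its liminf -/

/-- A real sequence with values in `[0, C]` has a subsequence converging to its `liminf`. -/
theorem exists_strictMono_tendsto_liminf {u : ℕ → ℝ} {C : ℝ} (h0 : ∀ k, 0 ≤ u k) (hC : ∀ k, u k ≤ C) :
    ∃ r : ℕ → ℕ, StrictMono r ∧ Tendsto (fun k => u (r k)) atTop (𝓝 (liminf u atTop)) := by
  set ℓ := liminf u atTop with hℓ
  have hbdd : IsBoundedUnder (· ≥ ·) atTop u := isBoundedUnder_of ⟨0, h0⟩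
  have hcobdd : IsCoboundedUnder (· ≥ ·) atTop u := (isBoundedUnder_of ⟨C, hC⟩).isCoboundedUnder_ge
  have hfreq : ∀ n : ℕ, ∃ᶠ k in atTop, |u k - ℓ| < 1 / ((n : ℝ) + 1) := by
    intro n
    have hε : (0 : ℝ) < 1 / ((n : ℝ) + 1) := by positivity
    have h1 : ∃ᶠ k in atTop, u k < ℓ + 1 / ((n : ℝ) + 1) := frequently_lt_of_liminf_lt hcobdd (by linarith)
    have h2 : ∀ᶠ k in atTop, ℓ - 1 / ((n : ℝ) + 1) < u k := eventually_lt_of_lt_liminf (by linarith) hbdd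
    refine (h1.and_eventually h2).mono fun k hk => ?_
    rw [abs_lt]
    constructor <;> linarith [hk.1, hk.2]
  obtain ⟨r, hr, hrP⟩ := extraction_forall_of_frequently hfreq
  refine ⟨r, hr, ?_⟩
  rw [Metric.tendsto_atTop]
  intro ε hε
  obtain ⟨n₀, hn₀⟩ := exists_nat_one_div_lt hε
  refine ⟨n₀, fun n hn => ?_⟩
  rw [Real.dist_eq]
  calc |u (r n) - ℓ| < 1 / ((n : ℝ) + 1) := hrP n
    _ ≤ 1 / ((n₀ : ℝ) + 1) := by gcongr
    _ < ε := hn₀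

/-! ### 3. Re-indexing tangent families and tangent states along a subsequence -/

/-- A tangent family re-indexed along a strictly increasing map is a tangent family. -/
theorem isTangentFamily_reindex {σ a θ : ℝ} {u₀ : V3} {κ : ℝ} {N : ℕ → ℕ}
    {Φ : ∀ k, HardSphereFlow (Literature.Analysis.FluidPDE.Torus.geometry (Fin 3)) (hsDiameter σ (N k)) (N k + 1)}
    {Q : ∀ k, Measure (Config (N k + 1) (Fin 3) T3)} (h : IsTangentFamily σ a θ u₀ κ N Φ Q) {r : ℕ → ℕ}
    (hr : StrictMono r) :
    IsTangentFamily σ a θ u₀ κ (fun k => N (r k)) (fun k => Φ (r k)) (fun k => Q (r k)) := by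
  obtain ⟨hNk, hprob, hKL, η, hη, hstat⟩ := h
  exact ⟨fun k => (hr.id_le k).trans (hNk (r k)), fun k => hprob (r k), fun k => hKL (r k), fun k => η (r k),
    hη.comp hr.tendsto_atTop, fun k => hstat (r k)⟩

/-! ### 4. The blown-up Laplace functional is affine in the weight -/

/-- The inner blown-up exponential moment `x ↦ E_Q[exp(-∑ᵢ f(blown-up particle i))]` is integrable in the base
point and takes values in `[0, 1]` (for `f ≥ 0`). -/
theorem integrable_innerLaplace (σ : ℝ) (N : ℕ) (Q : Measure (Config (N + 1) (Fin 3) T3))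
    [IsProbabilityMeasure Q] {f : V3 × V3 → ℝ} (hf : Measurable f) (hf0 : ∀ p, 0 ≤ f p) :
    Integrable (fun x : T3 => ∫ z, Real.exp (-(∑ i, f (blowUpPoint (hsDiameter σ N) x (z i)))) ∂Q)
        (volume : Measure T3) ∧
      ∀ x : T3, 0 ≤ ∫ z, Real.exp (-(∑ i, f (blowUpPoint (hsDiameter σ N) x (z i)))) ∂Q ∧
        ∫ z, Real.exp (-(∑ i, f (blowUpPoint (hsDiameter σ N) x (z i)))) ∂Q ≤ 1 := by
  haveI : IsProbabilityMeasure (volume : Measure T3) := by rw [volume_pi]; infer_instance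
  have hFm : Measurable fun p : T3 × Config (N + 1) (Fin 3) T3 =>
      Real.exp (-(∑ i, f (blowUpPoint (hsDiameter σ N) p.1 (p.2 i)))) := (measurable_labelSum hf).neg.exp
  have hF1 : ∀ p : T3 × Config (N + 1) (Fin 3) T3,
      ‖Real.exp (-(∑ i, f (blowUpPoint (hsDiameter σ N) p.1 (p.2 i))))‖ ≤ 1 := fun p => by
    rw [Real.norm_eq_abs, abs_of_nonneg (Real.exp_pos _).le, Real.exp_le_one_iff, neg_nonpos]
    exact Finset.sum_nonneg fun i _ => hf0 _
  have hFi : Integrable (fun p : T3 × Config (N + 1) (Fin 3) T3 =>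
      Real.exp (-(∑ i, f (blowUpPoint (hsDiameter σ N) p.1 (p.2 i))))) ((volume : Measure T3).prod Q) :=
    Integrable.of_bound hFm.aestronglyMeasurable 1 (ae_of_all _ hF1)
  refine ⟨hFi.integral_prod_left, fun x => ⟨integral_nonneg fun z => (Real.exp_pos _).le, ?_⟩⟩
  have h := norm_integral_le_of_norm_le_const (μ := Q) (ae_of_all _ fun z => hF1 (x, z))
  rw [probReal_univ, mul_one, Real.norm_eq_abs] at h
  exact (le_abs_self _).trans h

/-- `(∫φ) · tangentLaplace σ φ = ∫ φ · inner` for a weight with `∫φ ≠ 0`. -/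
theorem integral_mul_tangentLaplace {σ : ℝ} {φ : T3 → ℝ} (hφi : (∫ x, φ x) ≠ 0) (N : ℕ)
    (Q : Measure (Config (N + 1) (Fin 3) T3)) (f : V3 × V3 → ℝ) :
    (∫ x, φ x) * tangentLaplace σ φ N Q f =
      ∫ x, φ x * ∫ z, Real.exp (-(∑ i, f (blowUpPoint (hsDiameter σ N) x (z i)))) ∂Q := by
  rw [tangentLaplace, ← mul_assoc, mul_inv_cancel₀ hφi, one_mul]

/-- With the unit weight the tangent Laplace functional is the plain base-point average of the inner moment. -/
theorem tangentLaplace_one {σ : ℝ} (N : ℕ) (Q : Measure (Config (N + 1) (Fin 3) T3)) (f : V3 × V3 → ℝ) :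
    tangentLaplace σ (fun _ => (1 : ℝ)) N Q f =
      ∫ x, ∫ z, Real.exp (-(∑ i, f (blowUpPoint (hsDiameter σ N) x (z i)))) ∂Q := by
  haveI : IsProbabilityMeasure (volume : Measure T3) := by rw [volume_pi]; infer_instance
  rw [tangentLaplace]
  simp only [integral_const, probReal_univ, one_smul, inv_one, one_mul]

/-- **Affinity in the weight**: `tangentLaplace σ 1 = (∫φ) · tangentLaplace σ φ + ∫ (1 - φ) · inner`. -/
theorem tangentLaplace_one_eq_add {σ : ℝ} {φ : T3 → ℝ} (hφ : Continuous φ) (hφi : (∫ x, φ x) ≠ 0)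
    (N : ℕ) (Q : Measure (Config (N + 1) (Fin 3) T3)) [IsProbabilityMeasure Q] {f : V3 × V3 → ℝ}
    (hf : Measurable f) (hf0 : ∀ p, 0 ≤ f p) :
    tangentLaplace σ (fun _ => (1 : ℝ)) N Q f =
      (∫ x, φ x) * tangentLaplace σ φ N Q f +
        ∫ x, (1 - φ x) * ∫ z, Real.exp (-(∑ i, f (blowUpPoint (hsDiameter σ N) x (z i)))) ∂Q := by
  obtain ⟨hI, -⟩ := integrable_innerLaplace σ N Q hf hf0
  have hφb : ∃ C, ∀ x, ‖φ x‖ ≤ C := by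
    obtain ⟨C, hC⟩ := (isCompact_range hφ.norm).bddAbove
    exact ⟨C, fun x => hC (Set.mem_range_self x)⟩
  obtain ⟨C, hC⟩ := hφb
  have h1 : Integrable (fun x => φ x * ∫ z, Real.exp (-(∑ i, f (blowUpPoint (hsDiameter σ N) x (z i)))) ∂Q)
      volume :=
    hI.bdd_mul hφ.aestronglyMeasurable (ae_of_all _ hC)
  have h2 : Integrable (fun x => (1 - φ x) * ∫ z, Real.exp (-(∑ i, f (blowUpPoint (hsDiameter σ N) x (z i)))) ∂Q)
      volume :=
    hI.bdd_mul (continuous_const.sub hφ).aestronglyMeasurable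
      (ae_of_all _ fun x => show ‖1 - φ x‖ ≤ 1 + C from
        (norm_sub_le _ _).trans (by rw [norm_one]; exact add_le_add le_rfl (hC x)))
  rw [integral_mul_tangentLaplace hφi, tangentLaplace_one, ← integral_add h1 h2]
  refine integral_congr_ae (ae_of_all _ fun x => ?_)
  ring

/-! ### 5. Laplace functionals and window laws of two-point mixtures -/

/-- The Laplace functional is affine in the law. -/
theorem laplaceFunctional_smul_add (μ ν : Measure (PointConfig (V3 × V3))) [IsFiniteMeasure μ]
    [IsFiniteMeasure ν] (a b : ℝ≥0) {f : V3 × V3 → ℝ} (hf : Measurable f) (hfc : HasCompactSupport f)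
    (hf0 : ∀ p, 0 ≤ f p) :
    laplaceFunctional (a • μ + b • ν) f = a * laplaceFunctional μ f + b * laplaceFunctional ν f := by
  simp only [Literature.MathematicalPhysics.KineticTheory.PointProcess.laplaceFunctional]
  rw [integral_add_measure (integrable_exp_neg_finsum _ hf hfc hf0) (integrable_exp_neg_finsum _ hf hfc hf0),
    integral_smul_nnreal_measure, integral_smul_nnreal_measure]
  rfl

/-- Window laws of a two-point mixture. -/
private theorem windowLaw_smul_add {Λ : Set V3} (hΛ : MeasurableSet Λ) (μ ν : Measure (PointConfig (V3 × V3)))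
    (a b : ℝ≥0) : windowLaw Λ (a • μ + b • ν) = a • windowLaw Λ μ + b • windowLaw Λ ν := by
  simp only [Literature.MathematicalPhysics.KineticTheory.PointProcess.windowLaw]
  rw [Measure.map_add _ _ (measurable_windowRestrict hΛ), Measure.map_smul, Measure.map_smul]

/-! ### 6. Volumes of the centred cubes -/

/-- The centred cubes are measurable. -/
private theorem measurableSet_centredBox' (n : ℕ) : MeasurableSet (centredBox (d := Fin 3) n) := by
  have h : centredBox (d := Fin 3) n = ⋂ i, (fun y : V3 => y i) ⁻¹' Ico (-((n : ℝ) + 1)) ((n : ℝ) + 1) := by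
    ext y; simp [centredBox]
  rw [h]
  exact MeasurableSet.iInter fun i => measurableSet_Ico.preimage (by fun_prop)

/-- The centred cube `Λ_n` has volume `(2(n+1))³ ≥ n`. -/
private theorem natCast_le_volume_centredBox (n : ℕ) : (n : ℝ≥0∞) ≤ volume (centredBox (d := Fin 3) n) := by
  have h : centredBox (d := Fin 3) n =
      (WithLp.ofLp : V3 → Fin 3 → ℝ) ⁻¹' Set.pi univ fun _ => Ico (-((n : ℝ) + 1)) ((n : ℝ) + 1) := by
    ext y; simp [centredBox]
  rw [h, (PiLp.volume_preserving_ofLp (Fin 3)).measure_preimage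
    (MeasurableSet.univ_pi fun i => measurableSet_Ico).nullMeasurableSet, Real.volume_pi_Ico]
  simp only [Finset.prod_const, Finset.card_univ, Fintype.card_fin]
  have h1 : (n : ℝ≥0∞) ≤ ENNReal.ofReal ((n : ℝ) + 1 - -((n : ℝ) + 1)) := by
    rw [← ENNReal.ofReal_natCast]
    exact ENNReal.ofReal_le_ofReal (by linarith)
  have h2 : (1 : ℝ≥0∞) ≤ ENNReal.ofReal ((n : ℝ) + 1 - -((n : ℝ) + 1)) := by
    rw [← ENNReal.ofReal_one]
    exact ENNReal.ofReal_le_ofReal (by linarith [n.cast_nonneg (α := ℝ)])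
  calc (n : ℝ≥0∞) ≤ ENNReal.ofReal ((n : ℝ) + 1 - -((n : ℝ) + 1)) := h1
    _ = ENNReal.ofReal ((n : ℝ) + 1 - -((n : ℝ) + 1)) ^ 1 := (pow_one _).symm
    _ ≤ ENNReal.ofReal ((n : ℝ) + 1 - -((n : ℝ) + 1)) ^ 3 := pow_le_pow_right₀ h2 (by norm_num)

/-- `c / |Λ_n| → 0` for a finite constant `c`. -/
private theorem tendsto_const_div_volume_centredBox {c : ℝ≥0∞} (hc : c ≠ ∞) :
    Tendsto (fun n : ℕ => c / volume (centredBox (d := Fin 3) n)) atTop (𝓝 0) := by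
  have h1 : Tendsto (fun n : ℕ => c * (n : ℝ≥0∞)⁻¹) atTop (𝓝 0) := by
    have := ENNReal.Tendsto.const_mul ENNReal.tendsto_inv_nat_nhds_zero (Or.inr hc)
    rwa [mul_zero] at this
  refine tendsto_of_tendsto_of_tendsto_of_le_of_le tendsto_const_nhds h1 (fun _ => bot_le) fun n => ?_
  exact ENNReal.div_le_div_left (natCast_le_volume_centredBox n) c

/-! ### 7. Affinity of the specific relative entropy (the half we need) -/

/-- **AFFINITY OF THE SPECIFIC RELATIVE ENTROPY, lower half** (registered stub `stub_specificRelEntropyMixture` of this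
helper file; line `FirstLemma`, crux stmt-AtomisticToContinuum-14135): for probability laws `μ, ν, G` on configurations and
`0 ≤ t ≤ 1`, `t · h(μ | G) ≤ h(t μ + (1 - t) ν | G)` — window by window the reverse convexity of `KL` costs at most
`log 2`, which is negligible per unit volume of the centred cubes. -/
theorem stub_specificRelEntropyMixture (μ ν G : Measure (PointConfig (V3 × V3))) [IsProbabilityMeasure μ]
    [IsProbabilityMeasure ν] [IsProbabilityMeasure G] {t : ℝ} (ht0 : 0 ≤ t) (ht1 : t ≤ 1) :
    ENNReal.ofReal t * specificRelEntropy μ G ≤ specificRelEntropy (t.toNNReal • μ + (1 - t).toNNReal • ν) G := by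
  set M : Measure (PointConfig (V3 × V3)) := t.toNNReal • μ + (1 - t).toNNReal • ν with hM
  set v : ℕ → ℝ≥0∞ := fun n => volume (centredBox (d := Fin 3) n) with hv
  set A : ℕ → ℝ≥0∞ := fun n => klDiv (windowLaw (centredBox n) μ) (windowLaw (centredBox n) G) / v n with hA
  set B : ℕ → ℝ≥0∞ := fun n => klDiv (windowLaw (centredBox n) M) (windowLaw (centredBox n) G) / v n with hB
  have hstep : ∀ n, ENNReal.ofReal t * A n ≤ B n + ENNReal.ofReal (Real.log 2) / v n := by
    intro n
    haveI := isProbabilityMeasure_windowLaw (M := V3) (measurableSet_centredBox' n) μ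
    haveI := isProbabilityMeasure_windowLaw (M := V3) (measurableSet_centredBox' n) ν
    haveI := isProbabilityMeasure_windowLaw (M := V3) (measurableSet_centredBox' n) G
    have h := ofReal_mul_klDiv_le_klDiv_mix_add_log_two (windowLaw (centredBox n) μ) (windowLaw (centredBox n) ν)
      (windowLaw (centredBox n) G) ht0 ht1
    rw [← windowLaw_smul_add (measurableSet_centredBox' n)] at h
    rw [hA, hB]
    simp only
    rw [mul_div_assoc', ← ENNReal.add_div]  -- hmm
    exact ENNReal.div_le_div_right h _
  change ENNReal.ofReal t * limsup A atTop ≤ limsup B atTop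
  rw [← ENNReal.limsup_const_mul_of_ne_top ENNReal.ofReal_ne_top]
  refine ENNReal.le_of_forall_pos_le_add fun ε hε _ => ?_
  have hev : ∀ᶠ n in atTop, ENNReal.ofReal (Real.log 2) / v n ≤ ε :=
    ((tendsto_order.1 (tendsto_const_div_volume_centredBox ENNReal.ofReal_ne_top)).2 ε
      (by exact_mod_cast hε)).mono fun n hn => hn.le
  have hev' : ∀ᶠ n in atTop, ENNReal.ofReal t * A n ≤ B n + ε :=
    hev.mono fun n hn => (hstep n).trans (add_le_add le_rfl hn)
  calc limsup (fun n => ENNReal.ofReal t * A n) atTop ≤ limsup (fun n => B n + (ε : ℝ≥0∞)) atTop :=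
        limsup_le_limsup hev'
    _ = limsup B atTop + ε := limsup_add_const atTop B ε (by isBoundedDefault) (by isBoundedDefault)


end Summit.AtomisticToContinuum.HydrodynamicLimit.Theorems.KiferCompactification

end
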